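import Literature.Computability.AlgebraicComplexity.StrongUSP

/-!
# ω-census, family (b1-S): a verified strong-USP checker (unique silent 3D matching), kernel-evaluable

HONEST FRAMING (pub-omega census; verbatim): lottery ticket; floor = certified bounds/negative ranges.
Census bookkeeping, not progress on `ω` (tree: `ω < 2.373`; every strong-USP row is `≥ 2.65`).

`IsStrongUSP row` (CKSU 2005 §3, tree `Literature…StrongUSP`, p323357) quantifies over three permutations of
the `s` rows; `decide` on it is feasible only for `s ≤ 4`, while the census objects of the STPP track are the
maximum strong USPs of Anderson–Ji–Xu's table: `(8,5)`, `(14,6)`, … .  This file provides the checker the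
seat's enumerator (`uspcount`) is built on, with a soundness proof:

* `uspSilent row a b c` — the ordered row triple `(a,b,c)` is SILENT: no coordinate `i` has exactly two of
  `row a i = 1`, `row b i = 2`, `row c i = 3` (`USPExactlyTwo`, symbols coded `0,1,2`).  With `π₁ = 1` WLOG
  (`isStrongUSP_iff_fix_first`), `row` FAILS to be a strong USP iff some `(π₂, π₃) ≠ (1,1)` has
  `(u, π₂ u, π₃ u)` silent for every `u`, i.e. iff the tripartite hypergraph of silent triples has a perfect
  matching other than the diagonal `{(u,u,u)}` (diagonal triples are always silent).
* `suspSearch row rest avS avT moved` — structurally recursive exhaustive search: assign to the rows of `rest`,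
  in order, a σ-image from `avS` and a τ-image from `avT` forming a silent triple; returns `true` iff every
  COMPLETE assignment reached has `moved = false`, i.e. is the diagonal.  `suspCheck row ord` runs it along a
  caller-chosen row order `ord` (any nodup list covering all rows — the order only affects kernel time).
* `isStrongUSP_of_suspCheck : suspCheck row ord = true → IsStrongUSP row` — soundness, by the invariant
  `suspSearch_sound` (induction on `rest`, following the branch `b = π₂ u`, `c = π₃ u`).

The ω-rows for these instances follow in sibling files once `omega_le_div_of_isStrongUSP` (lit seat,
`StrongUSPOmegaBound.lean`) is in the tree.  Reach of THIS (unpruned) search at default heartbeats: the `(8,5)`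
puzzles below (≈ 10² search nodes); Anderson–Le's `(14,6)` puzzle needs ≈ 8·10⁶ nodes even with the
max-moved-row decomposition and is left to a pruned / certificate-checking successor of this file.  References: Cohn–Kleinberg–Szegedy–Umans, FOCS 2005
(arXiv:math/0511460) §3; Anderson–Ji–Xu, SAT 2020 / arXiv:2301.00074 §3.1 (π₁ = 1; 3D-matching formulation).
-/

namespace Summit.MatrixMultiplication.OmegaCensus

open Literature.Computability.AlgebraicComplexity Equiv

variable {s k : ℕ}

/-- The ordered row triple `(a, b, c)` is SILENT: no coordinate certifies the strong-USP condition
("exactly two of `(π₁u)ᵢ = 1, (π₂u)ᵢ = 2, (π₃u)ᵢ = 3`") for `π₁ u = a, π₂ u = b, π₃ u = c`.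
[cite: CohnKleinbergSzegedyUmans2005, §3 (p. 5), definition of a strong USP] -/
def uspSilent (row : Fin s → Fin k → Fin 3) (a b c : Fin s) : Bool :=
  decide (∀ i : Fin k, ¬ USPExactlyTwo (row a i) (row b i) (row c i))

/-- Exhaustive search over partial silent 3D matchings (structural recursion on the list of rows still to be
assigned): `avS` / `avT` are the σ- / τ-images still available, `moved` records whether some assigned row
`u` got `(σ u, τ u) ≠ (u, u)`.  Value `true` iff every complete silent assignment along this enumeration is the
diagonal. [cite: AndersonJiXu2020, §3.1 (3D-matching formulation of strong USP verification)] -/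
def suspSearch (row : Fin s → Fin k → Fin 3) : List (Fin s) → List (Fin s) → List (Fin s) → Bool → Bool
  | [], _, _, moved => !moved
  | u :: rest, avS, avT, moved =>
      avS.all fun b => avT.all fun c =>
        !uspSilent row u b c || suspSearch row rest (avS.erase b) (avT.erase c) (moved || !(b == u && c == u))

/-- The checker: `ord` must list every row exactly once (checked), then the search runs along `ord` with all
rows available as σ- and τ-images. [cite: AndersonJiXu2020, §3.1] -/
def suspCheck (row : Fin s → Fin k → Fin 3) (ord : List (Fin s)) : Bool :=
  decide (ord.Nodup) && ((List.finRange s).all fun v => decide (v ∈ ord)) &&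
    suspSearch row ord (List.finRange s) (List.finRange s) false

/-- **Invariant of the search.** If `(v, π₂ v, π₃ v)` is silent for every row, then along any branch that keeps
`π₂ v ∈ avS`, `π₃ v ∈ avT` for the unassigned rows, `suspSearch … moved = true` forces `moved = false` and
`π₂ v = v`, `π₃ v = v` on the unassigned rows. [folklore] -/
theorem suspSearch_sound {row : Fin s → Fin k → Fin 3} (π₂ π₃ : Perm (Fin s))
    (hsil : ∀ v, uspSilent row v (π₂ v) (π₃ v) = true) :
    ∀ (rest avS avT : List (Fin s)) (moved : Bool), rest.Nodup →
      (∀ v ∈ rest, π₂ v ∈ avS) → (∀ v ∈ rest, π₃ v ∈ avT) →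
      suspSearch row rest avS avT moved = true →
      moved = false ∧ ∀ v ∈ rest, π₂ v = v ∧ π₃ v = v
  | [], avS, avT, moved, _, _, _, h => by
      refine ⟨by simpa [suspSearch] using h, ?_⟩
      intro v hv; simp at hv
  | u :: rest, avS, avT, moved, hnd, hS, hT, h => by
      rw [List.nodup_cons] at hnd
      obtain ⟨hu, hnd'⟩ := hnd
      simp only [suspSearch, List.all_eq_true, Bool.or_eq_true, Bool.not_eq_true'] at h
      have hb : π₂ u ∈ avS := hS u (List.mem_cons_self)
      have hc : π₃ u ∈ avT := hT u (List.mem_cons_self)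
      rcases h (π₂ u) hb (π₃ u) hc with hns | hrec
      · exact absurd (hsil u) (by rw [hns]; decide)
      · have hS' : ∀ v ∈ rest, π₂ v ∈ avS.erase (π₂ u) := fun v hv =>
          (List.mem_erase_of_ne (fun e => (ne_of_mem_of_not_mem hv hu) (π₂.injective e))).2
            (hS v (List.mem_cons_of_mem u hv))
        have hT' : ∀ v ∈ rest, π₃ v ∈ avT.erase (π₃ u) := fun v hv =>
          (List.mem_erase_of_ne (fun e => (ne_of_mem_of_not_mem hv hu) (π₃.injective e))).2
            (hT v (List.mem_cons_of_mem u hv))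
        obtain ⟨hm, hfix⟩ := suspSearch_sound π₂ π₃ hsil rest _ _ _ hnd' hS' hT' hrec
        simp only [Bool.or_eq_false_iff, Bool.not_eq_eq_eq_not, Bool.not_false, Bool.and_eq_true,
          beq_iff_eq] at hm
        obtain ⟨hm0, hbu, hcu⟩ := hm
        refine ⟨hm0, ?_⟩
        intro v hv
        rcases List.mem_cons.1 hv with rfl | hv'
        · exact ⟨hbu, hcu⟩
        · exact hfix v hv'

/-- **Soundness of the checker**: `suspCheck row ord = true` implies that `row` is a strong USP (CKSU 2005 §3),
for any row order `ord`.  (With `π₁ = 1` by `isStrongUSP_iff_fix_first`: if no coordinate certifies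
`(π₂, π₃)`, every `(v, π₂ v, π₃ v)` is silent, and the invariant forces `π₂ = π₃ = 1`.)
[cite: CohnKleinbergSzegedyUmans2005, §3 (p. 5)] [cite: AndersonJiXu2020, §3.1] -/
theorem isStrongUSP_of_suspCheck {row : Fin s → Fin k → Fin 3} {ord : List (Fin s)}
    (h : suspCheck row ord = true) : IsStrongUSP row := by
  rw [isStrongUSP_iff_fix_first]
  intro π₂ π₃
  by_cases hex : ∃ u : Fin s, ∃ i : Fin k, USPExactlyTwo (row u i) (row (π₂ u) i) (row (π₃ u) i)
  · exact Or.inr hex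
  · left
    simp only [not_exists] at hex
    have hsil : ∀ v, uspSilent row v (π₂ v) (π₃ v) = true := fun v => by
      simp only [uspSilent, decide_eq_true_eq]; exact hex v
    simp only [suspCheck, Bool.and_eq_true, decide_eq_true_eq, List.all_eq_true] at h
    obtain ⟨⟨hnd, hcov⟩, hsearch⟩ := h
    have hcov' : ∀ v : Fin s, v ∈ ord := fun v => hcov v (List.mem_finRange v)
    obtain ⟨-, hfix⟩ := suspSearch_sound π₂ π₃ hsil ord _ _ false hnd
      (fun v _ => List.mem_finRange _) (fun v _ => List.mem_finRange _) hsearch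
    exact ⟨Equiv.ext fun v => (hfix v (hcov' v)).1, Equiv.ext fun v => (hfix v (hcov' v)).2⟩

/-! ## First instances -/

/-- CKSU's first strong USP family at `k = 1` (Prop. 11: size `2^k`, width `2k`; here the puzzle `{33, 12}`, i.e.
`{22, 01}` in the tree's `0,1,2` coding) passes `suspCheck`, hence is a strong USP.
[cite: CohnKleinbergSzegedyUmans2005, Proposition 11 (§3, p. 5)] -/
theorem isStrongUSP_prop11_k1 : IsStrongUSP ![![2, 2], ![0, 1]] :=
  isStrongUSP_of_suspCheck (ord := [0, 1]) (by decide +kernel)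

/-- A maximum strong USP of width 5 (size 8 = `s_max^SUSP(5)`, Anderson–Ji–Xu 2020 Table 3): the class
representative `{11111, 11123, 11233, 23113, 23122, 23312, 33221, 33232}` of the STPP-track census
(stpp-1 kit j155983, item `stpp1-census-k5-s8-susp-00`; property verdict ×3: stpp-1 C engine, stpp-3
decide.py v0.1.1, referee gen 138), here certified in the kernel: `suspCheck` along the identity row order.
[cite: AndersonJiXu2020, Table 3 (k = 5 column, s_max = 8)] -/
theorem isStrongUSP_k5_s8_rep00 :
    IsStrongUSP ![![0,0,0,0,0], ![0,0,0,1,2], ![0,0,1,2,2], ![1,2,0,0,2], ![1,2,0,1,1], ![1,2,2,0,1],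
      ![2,2,1,1,0], ![2,2,1,2,1]] :=
  isStrongUSP_of_suspCheck (ord := [0, 1, 2, 3, 4, 5, 6, 7]) (by decide +kernel)

/-- Anderson–Le's printed "Simplifiable (8,5)-SUSP" `{11111, 12231, 12312, 13222, 31132, 32212, 32223, 33122}`
(arXiv:2307.06463, Appendix, p. 20), AS PRINTED (symbols `1,2,3` coded `0,1,2`), certified a strong USP in the kernel.
[cite: AndersonLe2023, Appendix (p. 20), "Simplifiable (8,5)-SUSP"] -/
theorem isStrongUSP_AndersonLe_8_5 :
    IsStrongUSP ![![0,0,0,0,0], ![0,1,1,2,0], ![0,1,2,0,1], ![0,2,1,1,1], ![2,0,0,2,1], ![2,1,1,0,1],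
      ![2,1,1,1,2], ![2,2,0,1,1]] :=
  isStrongUSP_of_suspCheck (ord := [0, 1, 2, 3, 4, 5, 6, 7]) (by decide +kernel)

end Summit.MatrixMultiplication.OmegaCensus
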